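import Literature.NumberTheory.GaloisRepresentations.WeilDeligneOfGalois
import Literature.NumberTheory.GaloisRepresentations.WeilGroupFrobeniusPowers
import Literature.RepresentationTheory.Semisimple.BurnsideMatrixSpan
import HarnessLib

/-!
# Irreducible Weil–Deligne representations: basic facts
(crux stmt-Langlands-14329 `IrreducibilityBySelfDuality.IrreducibleOffSector`, supports kit
`square-integrable-place` §1; `--supports` file, lead a1; STRUCTURAL: Literature imports only)

Shared base for the kit's algebra lemmas A1-irr / A1-ind / L2 / L3 / L4:

* `isSubrep_ker_N` — `ker N` is a sub-Weil–Deligne representation (the relation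
  `ρ(w) N = q^{deg w} N ρ(w)` and `q^{deg w} ≠ 0`); hence
  `N_eq_zero_of_isIrreducible` — an IRREDUCIBLE Weil–Deligne representation has `N = 0`
  (Tate, Corvallis (4.1.3)–(4.1.5)), and irreducibility is irreducibility of `ρ(W_F)` alone
  (`eq_bot_or_eq_top_of_isIrreducible`, `isIrreducible_of_forall_stable`,
  `rho_isIrreducible_of_isIrreducible`, `isIrreducible_of_rho_isIrreducible` — the bridge to
  Mathlib's `Representation.IsIrreducible`).
* `exists_glHom r` — a framed form `φ : W_F →* GL_n(C)` of `r.ρ` on `Fin n → C`, with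
  `glStd_comp_eq_of_forall_coe_eq : glStd ∘ φ = r.ρ`; Burnside (tree theorem
  `Literature.RepresentationTheory.Semisimple.span_eq_top_of_isIrreducible`) in Weil–Deligne
  clothes: `span_toMatrix'_eq_top_of_isIrreducible` (algebraically closed `C`) and the converse
  `isIrreducible_of_span_toMatrix'_eq_top` (any `C`).
* `toMatrix'_ρ_eq_of_N_eq_zero` — if `r = (ρ_WD, N)` is attached to `ρW` by the
  Grothendieck–Deligne recipe (`IsWeilDeligneOfLadic`) and `N = 0`, then `ρ_WD = ρW` on all of
  `W_F` (as matrices; every `w` is `Φ^{-deg w} · (Φ^{deg w} w)` with the second factor in `I_F`,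
  tree lemma `WeilGroup.zpow_deg_mul_mem_inertia`), `ρ_apply_eq_mulVec_of_N_eq_zero`.

References: Deligne, Antwerp II (1973) §8.4; Tate, Corvallis 1979, (4.1.2)–(4.2.1);
Curtis–Reiner (27.4) (Burnside).
-/

noncomputable section

set_option linter.dupNamespace false

open scoped MatrixGroups Matrix
open Module
open Literature.NumberTheory.GaloisRepresentations
open Literature.NumberTheory.GaloisRepresentations.WeilGroup

namespace Summit.Langlands.Langlands.Theorems.IrreducibleOffSector.SquareIntegrablePlace

variable {F : Type*} [Field F] [ValuativeRel F] [TopologicalSpace F] [IsNonarchimedeanLocalField F]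

variable {C : Type*} [Field C] [CharZero C]

section General

variable {V : Type*} [AddCommGroup V] [Module C V]

/-! ### `ker N` and `N = 0` for irreducible Weil–Deligne representations -/

/-- `ker N` is a sub-Weil–Deligne representation: `N (ρ w v) = q^{-deg w} ρ w (N v)`.
[cite: TateCorvallis1979, (4.1.5)] -/
theorem isSubrep_ker_N (r : WeilDeligneRep F C V) : r.IsSubrep (LinearMap.ker r.N) := by
  refine ⟨fun w v hv => ?_, fun v hv => ?_⟩
  · simp only [Submodule.mem_comap, LinearMap.mem_ker] at hv ⊢
    have h := r.ρ_N_apply w v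
    rw [hv, map_zero] at h
    exact (smul_eq_zero.mp h.symm).resolve_left
      (WeilDeligneRep.residueFieldCard_zpow_ne_zero _)
  · simp only [Submodule.mem_comap, LinearMap.mem_ker] at hv ⊢
    rw [hv, map_zero]

/-- `⊥` is a sub-Weil–Deligne representation. [folklore] -/
theorem isSubrep_bot (r : WeilDeligneRep F C V) : r.IsSubrep ⊥ :=
  ⟨fun _ => bot_le, bot_le⟩

/-- `⊤` is a sub-Weil–Deligne representation. [folklore] -/
theorem isSubrep_top (r : WeilDeligneRep F C V) : r.IsSubrep ⊤ :=
  ⟨fun _ => by simp, by simp⟩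

/-- **An irreducible Weil–Deligne representation has trivial monodromy** (`ker N` is a non-zero
sub-representation since `N` is nilpotent and `V ≠ 0`). [cite: TateCorvallis1979, (4.1.5)] -/
theorem N_eq_zero_of_isIrreducible {r : WeilDeligneRep F C V} (h : r.IsIrreducible) :
    r.N = 0 := by
  obtain ⟨hV, hirr⟩ := h
  rcases hirr _ (isSubrep_ker_N r) with hbot | htop
  · exfalso
    obtain ⟨k, hk⟩ := r.isNilpotent_N
    have hinj : Function.Injective r.N := LinearMap.ker_eq_bot.mp hbot
    have hinjk : Function.Injective (r.N ^ k) := by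
      rw [Module.End.coe_pow]
      exact hinj.iterate k
    rw [hk] at hinjk
    obtain ⟨v, hv⟩ := exists_ne (0 : V)
    exact hv (hinjk (by simp))
  · exact LinearMap.ker_eq_top.mp htop

/-- For an irreducible Weil–Deligne representation every `ρ(W_F)`-stable subspace is `⊥` or `⊤`
(stability under `N = 0` is automatic). [cite: TateCorvallis1979, (4.1.5)] -/
theorem eq_bot_or_eq_top_of_isIrreducible {r : WeilDeligneRep F C V} (h : r.IsIrreducible)
    (p : Submodule C V) (hp : ∀ w, p ≤ p.comap (r.ρ w)) : p = ⊥ ∨ p = ⊤ :=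
  h.2 p ⟨hp, by rw [N_eq_zero_of_isIrreducible h]; intro v _; simp⟩

/-- Irreducibility of a Weil–Deligne representation from irreducibility of `ρ(W_F)` alone.
[folklore] -/
theorem isIrreducible_of_forall_stable (r : WeilDeligneRep F C V) [Nontrivial V]
    (h : ∀ p : Submodule C V, (∀ w, p ≤ p.comap (r.ρ w)) → p = ⊥ ∨ p = ⊤) :
    r.IsIrreducible :=
  ⟨‹_›, fun p hp => h p hp.1⟩

/-- An irreducible Weil–Deligne representation has irreducible Weil-group representation `r.ρ`
(Mathlib `Representation.IsIrreducible`). [folklore] -/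
theorem rho_isIrreducible_of_isIrreducible {r : WeilDeligneRep F C V} (h : r.IsIrreducible) :
    r.ρ.IsIrreducible := by
  haveI : Nontrivial V := h.1
  have hb : (⊥ : Subrepresentation r.ρ).toSubmodule = ⊥ := rfl
  have ht : (⊤ : Subrepresentation r.ρ).toSubmodule = ⊤ := rfl
  haveI : Nontrivial (Subrepresentation r.ρ) := ⟨⟨⊥, ⊤, fun e => by
    have e' := congrArg Subrepresentation.toSubmodule e
    rw [hb, ht] at e'
    exact bot_ne_top e'⟩⟩
  refine ⟨fun W => ?_⟩
  rcases eq_bot_or_eq_top_of_isIrreducible h W.toSubmodule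
      (fun w v hv => W.apply_mem_toSubmodule w hv) with h' | h'
  · exact Or.inl (Subrepresentation.toSubmodule_injective (by rw [h', hb]))
  · exact Or.inr (Subrepresentation.toSubmodule_injective (by rw [h', ht]))

/-- Conversely, if `r.ρ` is irreducible as a representation of `W_F` then `r` is an irreducible
Weil–Deligne representation. [folklore] -/
theorem isIrreducible_of_rho_isIrreducible {r : WeilDeligneRep F C V}
    (h : r.ρ.IsIrreducible) : r.IsIrreducible := by
  have hb : (⊥ : Subrepresentation r.ρ).toSubmodule = ⊥ := rfl
  have ht : (⊤ : Subrepresentation r.ρ).toSubmodule = ⊤ := rfl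
  have hV : Nontrivial V := by
    by_contra hn
    haveI : Subsingleton V := not_nontrivial_iff_subsingleton.mp hn
    have hbt : (⊥ : Subrepresentation r.ρ) ≠ ⊤ := bot_ne_top
    exact hbt (Subrepresentation.toSubmodule_injective (Subsingleton.elim _ _))
  refine ⟨hV, fun p hp => ?_⟩
  let W : Subrepresentation r.ρ := ⟨p, fun w v hv => hp.1 w hv⟩
  rcases h.eq_bot_or_eq_top W with h' | h'
  · exact Or.inl (by rw [← hb, ← h'])
  · exact Or.inr (by rw [← ht, ← h'])

end General

/-! ### Framed form and Burnside -/

section Framed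

variable {n : ℕ}

/-- A framed form `φ : W_F →* GL_n(C)` of the Weil-group representation of a Weil–Deligne
representation on `Fin n → C`: the matrices of `φ w` are those of `r.ρ w` in the standard basis
(stated as an existence so that no definition is introduced in this proof file). [folklore] -/
theorem exists_glHom (r : WeilDeligneRep F C (Fin n → C)) :
    ∃ φ : WeilGroup F →* GL (Fin n) C,
      ∀ w, ((φ w : GL (Fin n) C) : Matrix (Fin n) (Fin n) C) = LinearMap.toMatrix' (r.ρ w) :=
  ⟨{ toFun := fun w =>
      { val := LinearMap.toMatrix' (r.ρ w)
        inv := LinearMap.toMatrix' (r.ρ w⁻¹)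
        val_inv := by
          rw [← LinearMap.toMatrix'_mul, ← map_mul, mul_inv_cancel, map_one,
            LinearMap.toMatrix'_one]
        inv_val := by
          rw [← LinearMap.toMatrix'_mul, ← map_mul, inv_mul_cancel, map_one,
            LinearMap.toMatrix'_one] }
     map_one' := by
       ext : 1
       simp [LinearMap.toMatrix'_one]
     map_mul' := fun w w' => by
       ext : 1
       simp [LinearMap.toMatrix'_mul] }, fun _ => rfl⟩

/-- The standard representation composed with a framed form of `r.ρ` is `r.ρ`. [folklore] -/
theorem glStd_comp_eq_of_forall_coe_eq {r : WeilDeligneRep F C (Fin n → C)}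
    {φ : WeilGroup F →* GL (Fin n) C}
    (hφ : ∀ w, ((φ w : GL (Fin n) C) : Matrix (Fin n) (Fin n) C) = LinearMap.toMatrix' (r.ρ w)) :
    (glStdRepresentation (Fin n) C).comp φ = r.ρ := by
  refine MonoidHom.ext fun w => LinearMap.ext fun v => ?_
  change ((φ w : GL (Fin n) C) : Matrix (Fin n) (Fin n) C) *ᵥ v = r.ρ w v
  rw [hφ w, LinearMap.toMatrix'_mulVec]

/-- An irreducible Weil–Deligne representation lives in positive rank. [folklore] -/
theorem pos_of_isIrreducible {r : WeilDeligneRep F C (Fin n → C)} (h : r.IsIrreducible) :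
    0 < n := by
  rcases Nat.eq_zero_or_pos n with rfl | hn
  · exact absurd h.1 (not_nontrivial _)
  · exact hn

/-- **Burnside for Weil–Deligne representations.** Over an algebraically closed field the
matrices `[r.ρ w]`, `w ∈ W_F`, of an irreducible Weil–Deligne representation span `M_n(C)`.
[cite: CurtisReiner1962, (27.4)] -/
theorem span_toMatrix'_eq_top_of_isIrreducible [IsAlgClosed C]
    {r : WeilDeligneRep F C (Fin n → C)} (h : r.IsIrreducible) :
    Submodule.span C (Set.range fun w => LinearMap.toMatrix' (r.ρ w)) = ⊤ := by
  obtain ⟨φ, hφ⟩ := exists_glHom r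
  haveI : Representation.IsIrreducible ((glStdRepresentation (Fin n) C).comp φ) := by
    rw [glStd_comp_eq_of_forall_coe_eq hφ]
    exact rho_isIrreducible_of_isIrreducible h
  have key := Literature.RepresentationTheory.Semisimple.span_eq_top_of_isIrreducible φ
  simp_rw [hφ] at key
  exact key

/-- Conversely (any field `C` of characteristic zero): if the matrices `[r.ρ w]` span `M_n(C)`
and `0 < n`, then `r` is irreducible. [cite: CurtisReiner1962, (27.4)] -/
theorem isIrreducible_of_span_toMatrix'_eq_top (hn : 0 < n)
    {r : WeilDeligneRep F C (Fin n → C)}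
    (h : Submodule.span C (Set.range fun w => LinearMap.toMatrix' (r.ρ w)) = ⊤) :
    r.IsIrreducible := by
  obtain ⟨φ, hφ⟩ := exists_glHom r
  have h' : Submodule.span C
      (Set.range fun w => ((φ w : GL (Fin n) C) : Matrix (Fin n) (Fin n) C)) = ⊤ := by
    simp_rw [hφ]
    exact h
  have hirr := Literature.RepresentationTheory.Semisimple.isIrreducible_of_span_eq_top hn φ h'
  rw [glStd_comp_eq_of_forall_coe_eq hφ] at hirr
  exact isIrreducible_of_rho_isIrreducible hirr

/-! ### The Grothendieck–Deligne recipe with trivial monodromy -/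

/-- If `r = (ρ_WD, N)` is attached to `ρW` by the Grothendieck–Deligne recipe and `N = 0`, then
`[ρ_WD(w)] = ρW(w)` for EVERY `w ∈ W_F` (write `w = Φ^m u`; `exp(-t(u)·0) = 1`).
[cite: TateCorvallis1979, (4.2.1)] -/
theorem toMatrix'_ρ_eq_of_N_eq_zero {E : Type*} [Field E] [CharZero E]
    {ρW : WeilGroup F →* GL (Fin n) E} {r : WeilDeligneRep F E (Fin n → E)}
    (h : IsWeilDeligneOfLadic ρW r) (hN : r.N = 0) (w : WeilGroup F) :
    LinearMap.toMatrix' (r.ρ w) = ((ρW w : GL (Fin n) E) : Matrix (Fin n) (Fin n) E) := by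
  obtain ⟨t, U, Φ, -, -, hΦ, -, -, hρ⟩ := h
  have hmem : Φ ^ (WeilGroup.deg w) * w ∈ WeilGroup.inertia F :=
    WeilGroup.zpow_deg_mul_mem_inertia hΦ w
  have key := hρ (-WeilGroup.deg w) ⟨Φ ^ (WeilGroup.deg w) * w, hmem⟩
  have hw : Φ ^ (-WeilGroup.deg w) * (Φ ^ (WeilGroup.deg w) * w) = w := by
    rw [← mul_assoc, zpow_neg, inv_mul_cancel, one_mul]
  simp only [hw, hN, map_zero, smul_zero, neg_zero, IsNilpotent.exp_zero, mul_one] at key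
  exact key

/-- Pointwise form of `toMatrix'_ρ_eq_of_N_eq_zero`: `ρ_WD(w) v = ρW(w) · v`.
[cite: TateCorvallis1979, (4.2.1)] -/
theorem ρ_apply_eq_mulVec_of_N_eq_zero {E : Type*} [Field E] [CharZero E]
    {ρW : WeilGroup F →* GL (Fin n) E} {r : WeilDeligneRep F E (Fin n → E)}
    (h : IsWeilDeligneOfLadic ρW r) (hN : r.N = 0) (w : WeilGroup F) (v : Fin n → E) :
    r.ρ w v = ((ρW w : GL (Fin n) E) : Matrix (Fin n) (Fin n) E) *ᵥ v := by
  rw [← toMatrix'_ρ_eq_of_N_eq_zero h hN w, LinearMap.toMatrix'_mulVec]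

end Framed

end Summit.Langlands.Langlands.Theorems.IrreducibleOffSector.SquareIntegrablePlace

end
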